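import Literature.AnabelianGeometry.EtaleTheta.ThetaCohomology
import Summits.ABC.IUTFork.LanaEtaAlgorithm
import HarnessLib

/-!
# L-LANA objects XI quinquies: LANA's CONTAINMENT from [EtTh] Prop. 1.4 (iii) (Galois evaluation of the étale theta class)

Record-only file (D-0012) of the abc-iut cell (seat abc-iut-c312-4, L-LANA level, plan/LLANA-SPEC N14 Steps 2–6;
CONSUMES layer L2's REAL [EtTh] §1 objects — `ThetaSetting p`, `H¹(Π^tp_Ÿ, Δ_Θ) = ThetaSetting.H1` (`ContH1`), the
Kummer data `KummerData` (`(K̈^×)^∧ → H¹((Π^tp_Ÿ)^Θ, Δ_Θ)`), the étale theta classes `EtaleThetaData.thetaClasses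
= O^×_K̈ · η̈^Θ` and the TYPED STATEMENT `Prop14iiiValues` of [EtTh] Prop. 1.4 (iii) over `K̈`-rational non-cuspidal
points `NonCuspidalPoint` (seat abc-iut-L2-t1; a refereed, published result, typed as a `Prop`, NOT proved in the
tree)); TAKES NO SIDE on [IUTchIII] Cor. 3.12.

LANA §6.2 (g) p. 36: "An important part of the content of Theorem 3.11 (see also [IUTchIII] Prop. 3.5 (ii)) is that
the image of the map (say, `ψ_v`) from (the Frobenius-like version of) the theta monoid `M^Θ_{v,∞}` to the product of
`∞H¹(D_t, (l·Δ_Θ)(Π_v))` is contained in the image of `φ_v := ∏_t φ_{v,t}`" — `EtaSteps.Containment`, a HYPOTHESIS in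
gen 0/2/3's files. §6.1 p. 32 / §6.2 (f) p. 35: "When applied to Kummer classes associated to functions, this
restriction operation can be interpreted as the Kummer-theoretic analogue of evaluation at the points". [EtTh]
Prop. 1.4 (iii) p. 22: "if … `y ∈ Ÿ(L)` is a non-cuspidal point, then the restricted classes `O^×_K̈ · η̈^Θ|_y ∈
H¹(G_L, Δ_Θ) ≅ H¹(G_L, Ẑ(1)) ≅ (L^×)^∧ … lie in `L^× ⊆ (L^×)^∧` and are equal to the values `O^×_K̈ · Θ̈(y)`".

THIS FILE, over a theta setting `D`, an étale theta datum `E` and chosen `K̈`-rational non-cuspidal evaluation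
points `y_t` (L2 `NonCuspidalPoint`, carrying the decomposition group `D_{y_t} ≤ Π^tp_Ÿ` and the evaluation map
`ev_t : H¹(D_{y_t}, Δ_Θ) → (K̈^×)^∧` with `ev_t ∘ res ∘ κ = id` on constants):

* `ThetaSetting.intUnitsKdd D` — **`O^▷_{K̈}`** = the elements of `K̈^×` of absolute value `≤ 1` (⊇ `O^×_K̈`);
* `kappaAt E y : O^▷_{K̈} → H¹(D_y, Δ_Θ)` — **the [EtTh]-level local Kummer map at `y`** = restriction to `D_y` of
  (inflation of) the Kummer class (`ContH1.res ∘ inflTheta ∘ kumYdd ∘ toKddHat`), i.e. LANA's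
  `φ_{v,t} = (ι_t)_*⁻¹ ∘ κ_t` with the synchronization ALREADY BUILT IN ([EtTh]'s `H¹(G_K̈, Ẑ(1)) ≅ H¹(G_K̈, Δ_Θ)`
  is part of `kumYdd`); **injective with no hypothesis** (`kappaAt_injective`, from `evalAt_kum`);
* `EtaEvalSide.toEtaSteps` — the signature with `H1Y`, `thetaClasses`, `unitsEt`, `H1D t := H¹(D_{y_t}, Δ_Θ)`,
  `res_t`, `O t := O^▷_{K̈}`, `κ_t := kappaAt`, `sync := id` ALL REAL; `φ_v` injective, Containment ⟺ Factors,
  unique factorisation — no hypothesis;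
* **`res_mem_mrange_kappaAt_of_prop14iii`** — for every element of the étale-like theta monoid
  `M^Θ = O^×(Π_v) · ⟨θ(Π_v)⟩` and every evaluation point: `res_t(x) ∈ κ_t(O^▷_{K̈})`, GIVEN [EtTh] Prop. 1.4 (iii)
  (`Prop14iiiValues E`), that the printed "`≅`" `H¹(D_y, Δ_Θ) ≅ (K̈^×)^∧` is injective on the typed `evalAt`
  (`hev`), and that the theta value `Θ̈(y_t)` is INTEGRAL (`hint : ‖Θ̈(Ü(y_t))‖ ≤ 1`);
* **`containment_of_prop14iii`** — hence LANA's **Containment HOLDS** for this signature under those hypotheses plus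
  the p. 34 link `KummerImageEq` (the Frobenioid-theoretic theta monoid has Kummer image `M^Θ`): at the level of
  [EtTh] §1 and `K̈`-rational evaluation points, "the important part of the content of Theorem 3.11" IS [EtTh]
  Prop. 1.4 (iii) + integrality of the theta values — a kernel reduction, not an opinion.

HONEST SCOPE. (i) Level: [EtTh] §1 (square-root theta `Θ̈`, fixed level `Π^tp_Ÿ`, coefficients `Δ_Θ`), not LANA's
`∞`-colimit with `l`-th roots ([IUTchII] Prop. 1.4): `∞θ` is replaced by the submonoid generated by `θ`
(`thetaInf := closure θ` in the discharge theorem); (ii) evaluation points `K̈`-RATIONAL (`L = K̈`, as L2 typed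
Prop. 1.4 (iii)); the `l`-torsion points `x_t` of LANA's Figure 1 live over extensions of `K̈`; (iii) `hev`, `hint`,
`KummerImageEq`, `Prop14iiiValues` are explicit named hypotheses (the last a refereed published statement); nothing
of [IUTchIII] is asserted. [cite: LANA2026Report, §6.2 (g) p. 36, §6.2 (f) p. 35, §6.1 p. 32]
[cite: MochizukiEtTh2009, Prop 1.4 (iii) p.22] NOT here: any judgement.
-/

noncomputable section

namespace Summit.ABC
namespace IUTFork

open Literature.AnabelianGeometry.EtaleTheta
open scoped NNReal

variable {p : ℕ} [Fact p.Prime]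

/-! ## 1. `O^▷_{K̈}` and the [EtTh]-level local Kummer map at a `K̈`-rational point -/

namespace EtTh

variable (D : ThetaSetting p)

/-- **`O^▷_{K̈}`** (LANA §0.4 (b): "`O^▷_k = {a ∈ k | 0 < |a| ≤ 1}`"): the elements of `K̈^×` of absolute value
`≤ 1`, a submonoid of `K̈^×`. [cite: LANA2026Report, §0.4 (b) p. 8] -/
def intUnitsKdd : Submonoid (↥D.Kdd)ˣ where
  carrier := {a | ‖((a : D.Kdd) : PadicAlgCl p)‖ ≤ 1}
  one_mem' := by simp
  mul_mem' {a b} ha hb := by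
    simp only [Set.mem_setOf_eq, Units.val_mul, IntermediateField.coe_mul, norm_mul] at ha hb ⊢
    exact mul_le_one₀ ha (norm_nonneg _) hb

variable {D}

/-- Membership in `O^▷_{K̈}`. [cite: LANA2026Report, §0.4 (b) p. 8] -/
theorem mem_intUnitsKdd_iff (a : (↥D.Kdd)ˣ) : a ∈ intUnitsKdd D ↔ ‖((a : D.Kdd) : PadicAlgCl p)‖ ≤ 1 := Iff.rfl

/-- `O^×_K̈ ⊆ O^▷_{K̈}` (absolute value `= 1 ⟹ ≤ 1`). [cite: LANA2026Report, §0.4 (b) p. 8] -/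
theorem unitsOKdd_le_intUnitsKdd : D.unitsOKdd.toSubmonoid ≤ intUnitsKdd D := fun a ha => by
  rw [mem_intUnitsKdd_iff]
  exact le_of_eq ha

variable (E : D.EtaleThetaData)

/-- **The [EtTh]-level local Kummer map at a `K̈`-rational non-cuspidal point `y`**:
`O^▷_{K̈} ⊆ K̈^× → (K̈^×)^∧ → H¹((Π^tp_Ÿ)^Θ, Δ_Θ) → H¹(Π^tp_Ÿ, Δ_Θ) → H¹(D_y, Δ_Θ)` (Kummer class, inflation,
restriction to the decomposition group) — LANA's `φ_{v,t} = (ι_t)_*⁻¹ ∘ κ_t` at `t ↦ y`, with the identification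
`Ẑ(1) ≅ Δ_Θ` built into L2's `kumYdd`. [cite: LANA2026Report, §6.2 (g) p. 35] [cite: MochizukiEtTh2009, Prop 1.4 (iii) p.22] -/
def kappaAt (y : ThetaSetting.NonCuspidalPoint E.toKummerData) : ↥(intUnitsKdd D) →* D.H1 y.Dpt :=
  (ContH1.res D.toTheta D.DeltaTheta y.Dpt_le).comp
    ((D.inflTheta D.GtpYdd).comp (E.kumYdd.comp (E.toKddHat.comp (intUnitsKdd D).subtype)))

/-- `κ_y(a) = res_{D_y}(infl(κ(a)))`. [cite: LANA2026Report, §6.2 (g) p. 35] -/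
theorem kappaAt_apply (y : ThetaSetting.NonCuspidalPoint E.toKummerData) (a : ↥(intUnitsKdd D)) :
    kappaAt E y a =
      ContH1.res D.toTheta D.DeltaTheta y.Dpt_le (D.inflTheta D.GtpYdd (E.kumYdd (E.toKddHat a))) := rfl

/-- **Evaluation undoes `κ_y`**: `ev_y(κ_y(a)) = a ∈ (K̈^×)^∧` ("the restricted classes … lie in `L^× ⊆ (L^×)^∧`";
L2 field `evalAt_kum`). [cite: MochizukiEtTh2009, Prop 1.4 (iii) p.22] -/
theorem evalAt_kappaAt (y : ThetaSetting.NonCuspidalPoint E.toKummerData) (a : ↥(intUnitsKdd D)) :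
    y.evalAt (kappaAt E y a) = E.toKddHat a := by
  rw [kappaAt_apply]
  exact y.evalAt_kum _

/-- **`κ_y` is INJECTIVE — no hypothesis** (`ev_y ∘ κ_y = (K̈^× ↪ (K̈^×)^∧)`, injective by L2 `toKddHat_injective`).
[cite: LANA2026Report, §6.2 (g) p. 35] -/
theorem kappaAt_injective (y : ThetaSetting.NonCuspidalPoint E.toKummerData) :
    Function.Injective (kappaAt E y) := fun a b h => by
  have h' := congrArg y.evalAt h
  rw [evalAt_kappaAt, evalAt_kappaAt] at h'
  exact Subtype.ext (E.toKddHat_injective h')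

omit [Fact p.Prime] in
/-- **Integrality of theta values at unit arguments**: in any ultrametric normed field, `‖q̈‖ ≤ 1` and `‖Ü‖ = 1`
give `‖Θ̈(Ü)‖ ≤ 1` — every term `(-1)^n q̈^{n(n+1)} Ü^{2n+1}` has norm `‖q̈‖^{n(n+1)} ≤ 1` (L2 `norm_thetaDdotTerm`) and
the ultrametric inequality passes to the sum (Mathlib `IsUltrametricDist.norm_tsum_le_of_forall_le`, which also covers
a divergent `tsum`). [cite: MochizukiEtTh2009, Prop 1.4 p.21] -/
theorem norm_thetaDdot_le_one {𝕜 : Type*} [NormedField 𝕜] [IsUltrametricDist 𝕜] {q2 U : 𝕜}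
    (hq : ‖q2‖ ≤ 1) (hU : ‖U‖ = 1) : ‖thetaDdot q2 U‖ ≤ 1 := by
  unfold thetaDdot
  refine IsUltrametricDist.norm_tsum_le_of_forall_le fun n => ?_
  rw [norm_thetaDdotTerm, hU, one_zpow, mul_one]
  have hn : (0 : ℤ) ≤ n * (n + 1) := by
    rcases le_or_gt 0 n with h | h
    · exact mul_nonneg h (by omega)
    · exact mul_nonneg_of_nonpos_of_nonpos h.le (by omega)
  obtain ⟨k, hk⟩ := Int.eq_ofNat_of_zero_le hn
  rw [hk, zpow_natCast]
  exact pow_le_one₀ (norm_nonneg _) hq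

/-- `‖q̈‖ < 1` (`q̈² = q_X`, `‖q_X‖ < 1`). [cite: MochizukiEtTh2009, §1 p.13] -/
theorem norm_qdd_lt_one : ‖D.qdd‖ < 1 := by
  have h2 : ‖D.qdd‖ ^ 2 < 1 := by
    rw [← norm_pow]
    change ‖D.sqrtqX ^ 2‖ < 1
    rw [D.sqrtqX_sq]
    exact D.norm_qX_lt_one
  nlinarith [norm_nonneg D.qdd]

/-- Hence **`‖Θ̈(Ü(y))‖ ≤ 1` at every point with unit coordinate** — the integrality hypothesis `hint` of the
discharge theorems below, PROVED in that case. [cite: MochizukiEtTh2009, Prop 1.4 (iii) p.22] -/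
theorem norm_thetaDdot_coord_le_one (y : ThetaSetting.NonCuspidalPoint E.toKummerData)
    (hy : ‖((y.coord : D.Kdd) : PadicAlgCl p)‖ = 1) :
    ‖thetaDdot D.qdd ((y.coord : D.Kdd) : PadicAlgCl p)‖ ≤ 1 :=
  norm_thetaDdot_le_one (norm_qdd_lt_one (D := D)).le hy

end EtTh

/-! ## 2. The signature with Steps 2–6 at the [EtTh] level -/

/-- **Fig. 3 over [EtTh] §1 with `K̈`-rational evaluation points.** REAL: `H1Y`, `thetaClasses`, `unitsEt`, `H1D`,
`res`, `O`, `H1DΛ (= H1D)`, `kappa`, `sync (= id)`. Data: `∞θ` (a submonoid of the real `H¹` containing `θ`), the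
mono-theta side, the labels and their points `y_t`, the theta values slot. [cite: LANA2026Report, §6.2 pp. 33–36] -/
structure EtaEvalSide {D : ThetaSetting p} (E : D.EtaleThetaData) : Type 1 where
  /-- `∞θ(Π_v)` as a submonoid of `H¹(Π^tp_Ÿ, Δ_Θ)` -/
  thetaInf : Submonoid (D.H1 D.GtpYdd)
  /-- `θ(Π_v) ⊆ ∞θ(Π_v)` -/
  thetaClasses_subset : E.thetaClasses ⊆ thetaInf
  /-- `M^{Θ,Frob}_{v,∞}` -/
  MFrob : Type
  [instMFrob : CommMonoid MFrob]
  /-- `∞H¹(Π_{v,Ÿ}, Λ^{ext}_{Θ,v})` -/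
  H1Yext : Type
  [instH1Yext : CommGroup H1Yext]
  /-- the Kummer map of the theta monoid -/
  kum : MFrob →* H1Yext
  /-- `Θ-Λ-rgd` (6-2), onto the REAL `H¹(Π^tp_Ÿ, Δ_Θ)` -/
  rgd : H1Yext ≃* D.H1 D.GtpYdd
  /-- the labels `t` -/
  T : Type
  /-- the `K̈`-rational non-cuspidal evaluation point `y_t` under the label `t` -/
  pts : T → ThetaSetting.NonCuspidalPoint E.toKummerData
  /-- the theta values slot `(q_v^{t²})_t`, here in `O^▷_{K̈}` -/
  qPow : T → ↥(EtTh.intUnitsKdd D)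

attribute [instance] EtaEvalSide.instMFrob EtaEvalSide.instH1Yext

namespace EtaEvalSide

variable {D : ThetaSetting p} {E : D.EtaleThetaData} (S : EtaEvalSide E)

/-- **`EtaSteps` at the [EtTh] level** (module docstring §2). [cite: LANA2026Report, §6.2 pp. 33–36] -/
def toEtaSteps : EtaSteps where
  H1Y := D.H1 D.GtpYdd
  thetaClasses := E.thetaClasses
  thetaInf := S.thetaInf
  unitsEt := E.kumUnitsYdd.toSubmonoid
  thetaClasses_subset := S.thetaClasses_subset
  MFrob := S.MFrob
  H1Yext := S.H1Yext
  kum := S.kum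
  rgd := S.rgd
  T := S.T
  H1D t := D.H1 (S.pts t).Dpt
  res t := ContH1.res D.toTheta D.DeltaTheta (S.pts t).Dpt_le
  O _ := ↥(EtTh.intUnitsKdd D)
  H1DΛ t := D.H1 (S.pts t).Dpt
  kappa t := EtTh.kappaAt E (S.pts t)
  sync _ := MulEquiv.refl _
  qPow := S.qPow

/-- `φ_{v,t}` IS the [EtTh]-level local Kummer map `κ_{y_t}` (sync `= id`). [cite: LANA2026Report, §6.2 (g) p. 35] -/
theorem toEtaSteps_phi_apply (t : S.T) (a : ↥(EtTh.intUnitsKdd D)) :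
    S.toEtaSteps.phi t a = EtTh.kappaAt E (S.pts t) a := rfl

/-- `ψ_v` at `t` IS restriction to `D_{y_t}` of `rgd ∘ kum`. [cite: LANA2026Report, §6.2 (f) p. 36] -/
theorem toEtaSteps_psi_apply (m : S.MFrob) (t : S.T) :
    S.toEtaSteps.psi m t = ContH1.res D.toTheta D.DeltaTheta (S.pts t).Dpt_le (S.rgd (S.kum m)) := rfl

/-- **`φ_v` injective — no hypothesis.** [cite: LANA2026Report, §6.2 (g) p. 35] -/
theorem toEtaSteps_phiProd_injective : Function.Injective S.toEtaSteps.phiProd :=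
  S.toEtaSteps.phiProd_injective fun t => EtTh.kappaAt_injective E (S.pts t)

/-- **Containment ⟺ Factors — no hypothesis.** [cite: LANA2026Report, §6.2 (g) p. 36, §9.1 (f) p. 45] -/
theorem toEtaSteps_containment_iff_factors : S.toEtaSteps.Containment ↔ S.toEtaSteps.Factors :=
  S.toEtaSteps.containment_iff_factors fun t => EtTh.kappaAt_injective E (S.pts t)

/-- Unique factorisation — no hypothesis. [cite: LANA2026Report, §9.1 (f) p. 45] -/
theorem toEtaSteps_factorisation_unique (lam lam' : S.toEtaSteps.MFrob →* ∀ t, S.toEtaSteps.O t)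
    (h : S.toEtaSteps.phiProd.comp lam = S.toEtaSteps.psi) (h' : S.toEtaSteps.phiProd.comp lam' = S.toEtaSteps.psi) :
    lam = lam' :=
  S.toEtaSteps.factorisation_unique (fun t => EtTh.kappaAt_injective E (S.pts t)) lam lam' h h'

/-! ## 3. The discharge: Containment from [EtTh] Prop. 1.4 (iii) -/

/-- **Units restrict into `κ_t(O^▷)`**: a Kummer class of `u ∈ O^×_K̈` restricts at `y_t` to `κ_{y_t}(u)`, `u ∈ O^× ⊆ O^▷`
(definitional). [cite: LANA2026Report, §6.2 (d) p. 34, §6.2 (g) p. 35] -/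
theorem res_unit_mem_mrange_kappaAt (t : S.T) (x : D.H1 D.GtpYdd) (hx : x ∈ E.kumUnitsYdd) :
    ContH1.res D.toTheta D.DeltaTheta (S.pts t).Dpt_le x ∈ MonoidHom.mrange (EtTh.kappaAt E (S.pts t)) := by
  obtain ⟨c, ⟨a, ha, rfl⟩, rfl⟩ := hx
  exact ⟨⟨a, EtTh.unitsOKdd_le_intUnitsKdd ha⟩, rfl⟩

/-- **Theta classes restrict into `κ_t(O^▷)`, GIVEN [EtTh] Prop. 1.4 (iii)**: for `x ∈ O^×_K̈ · η̈^Θ`,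
`res_{y_t}(x) = κ_{y_t}(a · Θ̈(y_t))` with `a ∈ O^×_K̈`, provided the printed evaluation isomorphism is injective on the
typed `evalAt` (`hev`) and the theta value at `y_t` is integral (`hint`). [cite: MochizukiEtTh2009, Prop 1.4 (iii) p.22]
[cite: LANA2026Report, §6.2 (f) p. 35] -/
theorem res_thetaClass_mem_mrange_kappaAt (h14 : ThetaSetting.Prop14iiiValues E) (t : S.T)
    (hev : Function.Injective (S.pts t).evalAt)
    (hint : ‖thetaDdot D.qdd (((S.pts t).coord : D.Kdd) : PadicAlgCl p)‖ ≤ 1)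
    (x : D.H1 D.GtpYdd) (hx : x ∈ E.thetaClasses) :
    ContH1.res D.toTheta D.DeltaTheta (S.pts t).Dpt_le x ∈ MonoidHom.mrange (EtTh.kappaAt E (S.pts t)) := by
  obtain ⟨a, ha, v, hv, heval⟩ := h14 (S.pts t) x hx
  have hav : a * v ∈ EtTh.intUnitsKdd D := by
    rw [EtTh.mem_intUnitsKdd_iff, Units.val_mul, IntermediateField.coe_mul, norm_mul]
    have ha' : ‖((a : D.Kdd) : PadicAlgCl p)‖ = 1 := ha
    rw [ha', one_mul, hv]
    exact hint
  refine ⟨⟨a * v, hav⟩, hev ?_⟩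
  rw [EtTh.evalAt_kappaAt, heval]

/-- **The whole étale-like theta monoid restricts into `κ_t(O^▷)`** when `∞θ` is the submonoid generated by `θ`
([EtTh]-level reading of `M^Θ = O^×(Π_v) · ∞θ(Π_v)`), under the hypotheses of the previous two lemmas.
[cite: LANA2026Report, §6.2 (d) p. 34, §6.2 (g) p. 36] -/
theorem thetaMonoidEt_le_comap (hInf : S.thetaInf = Submonoid.closure E.thetaClasses)
    (h14 : ThetaSetting.Prop14iiiValues E) (t : S.T) (hev : Function.Injective (S.pts t).evalAt)
    (hint : ‖thetaDdot D.qdd (((S.pts t).coord : D.Kdd) : PadicAlgCl p)‖ ≤ 1) :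
    S.toEtaSteps.thetaMonoidEt ≤ (MonoidHom.mrange (EtTh.kappaAt E (S.pts t))).comap (S.toEtaSteps.res t) := by
  change E.kumUnitsYdd.toSubmonoid ⊔ S.thetaInf ≤ _
  rw [hInf]
  refine sup_le (fun x hx => ?_) (Submonoid.closure_le.mpr fun x hx => ?_)
  · exact S.res_unit_mem_mrange_kappaAt t x hx
  · exact S.res_thetaClass_mem_mrange_kappaAt h14 t hev hint x hx

/-- **LANA's CONTAINMENT from [EtTh] Prop. 1.4 (iii).** For the [EtTh]-level signature with `K̈`-rational evaluation
points and `∞θ := ⟨θ⟩`: if the Frobenioid-theoretic theta monoid has Kummer image `M^Θ = O^×(Π_v)·∞θ(Π_v)` (p. 34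
link, `KummerImageEq`), [EtTh] Prop. 1.4 (iii) holds (`Prop14iiiValues`, L2's typed statement of the refereed
result), the printed evaluation isomorphisms `H¹(D_{y_t}, Δ_Θ) ≅ (K̈^×)^∧` are injective on the typed `evalAt`, and
the theta values `Θ̈(y_t)` are integral — THEN "the image of `ψ_v` is contained in the image of `φ_v`" (p. 36).
[cite: LANA2026Report, §6.2 (g) p. 36] [cite: MochizukiEtTh2009, Prop 1.4 (iii) p.22] -/
theorem containment_of_prop14iii (hInf : S.thetaInf = Submonoid.closure E.thetaClasses)
    (hK : S.toEtaSteps.KummerImageEq) (h14 : ThetaSetting.Prop14iiiValues E)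
    (hev : ∀ t, Function.Injective (S.pts t).evalAt)
    (hint : ∀ t, ‖thetaDdot D.qdd (((S.pts t).coord : D.Kdd) : PadicAlgCl p)‖ ≤ 1) :
    S.toEtaSteps.Containment := by
  rintro _ ⟨m, rfl⟩
  have hm : S.rgd (S.kum m) ∈ S.toEtaSteps.thetaMonoidEt := S.toEtaSteps.rgd_kum_mem_thetaMonoidEt hK m
  have hcomp : ∀ t, ∃ o : ↥(EtTh.intUnitsKdd D),
      EtTh.kappaAt E (S.pts t) o = ContH1.res D.toTheta D.DeltaTheta (S.pts t).Dpt_le (S.rgd (S.kum m)) :=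
    fun t => S.thetaMonoidEt_le_comap hInf h14 t (hev t) (hint t) hm
  choose o ho using hcomp
  refine ⟨o, funext fun t => ?_⟩
  rw [EtaSteps.phiProd_apply, toEtaSteps_phi_apply, toEtaSteps_psi_apply, ho]

/-- … hence also the §9.1 (f) factorisation `λ` through `∏_t O^▷` EXISTS and is unique, under the same hypotheses.
[cite: LANA2026Report, §9.1 (f) p. 45] -/
theorem factors_of_prop14iii (hInf : S.thetaInf = Submonoid.closure E.thetaClasses)
    (hK : S.toEtaSteps.KummerImageEq) (h14 : ThetaSetting.Prop14iiiValues E)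
    (hev : ∀ t, Function.Injective (S.pts t).evalAt)
    (hint : ∀ t, ‖thetaDdot D.qdd (((S.pts t).coord : D.Kdd) : PadicAlgCl p)‖ ≤ 1) :
    S.toEtaSteps.Factors :=
  S.toEtaSteps_containment_iff_factors.mp (S.containment_of_prop14iii hInf hK h14 hev hint)

/-- **Containment from [EtTh] Prop. 1.4 (iii) at evaluation points with UNIT coordinates** — the integrality
hypothesis discharged (`EtTh.norm_thetaDdot_coord_le_one`); remaining hypotheses: the p. 34 Kummer-image link, the
typed [EtTh] Prop. 1.4 (iii), injectivity of the typed evaluation isomorphisms. [cite: LANA2026Report, §6.2 (g) p. 36]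
[cite: MochizukiEtTh2009, Prop 1.4 (iii) p.22] -/
theorem containment_of_prop14iii_of_unit_coords (hInf : S.thetaInf = Submonoid.closure E.thetaClasses)
    (hK : S.toEtaSteps.KummerImageEq) (h14 : ThetaSetting.Prop14iiiValues E)
    (hev : ∀ t, Function.Injective (S.pts t).evalAt)
    (hunit : ∀ t, ‖(((S.pts t).coord : D.Kdd) : PadicAlgCl p)‖ = 1) :
    S.toEtaSteps.Containment :=
  S.containment_of_prop14iii hInf hK h14 hev fun t => EtTh.norm_thetaDdot_coord_le_one E (S.pts t) (hunit t)

end EtaEvalSide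

end IUTFork

end Summit.ABC

end
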